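import Summits.CriticalPhenomena.PercolationContinuityZ3.Theorems.Transplant.SkelFrmFrom1RootHoldsQC
import Summits.CriticalPhenomena.PercolationContinuityZ3.Theorems.Transplant.SkelFrmFromBChoiceLinksPx
import Summits.CriticalPhenomena.PercolationContinuityZ3.Theorems.Transplant.SkelFrmFromBChoiceZonePx
import Summits.CriticalPhenomena.PercolationContinuityZ3.Theorems.Transplant.SkelFrmFromBChoiceZoneKPx
import HarnessLib

/-!
# U_s execution (RULING D-Us / Us-R2 / Us-R3, lead g22 2026-08-26; WAVE-Us-MANIFEST v1.0 §3 GEN row «SkelFrm1RootHoldsQC» ↦ «SkelFrmFrom1RootHoldsQCPx», §11):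
# **the first-axis ROOT LEG of the (R) column UNDER PROXIES** — `PlanarSkeletonFrmFrom.NegB.rootLegAt_frmQ3C_fstPx`, the GEN twin of
# «SkelFrmFrom1RootHoldsQC»'s `rootLegAt_frmQ3C_fst` with the one-type hypothesis `Φ.types = {t}` replaced by `hP : Φ.HasProxies t D`

builds on p205010 (kernel theorem, internal audit signed; external expert review pending) — nothing in this file uses p205010; NOTHING is claimed about the
OPEN node U_s `SamePDropOfSkeletonFrmScaled₁` (U `SamePDropOfSkeletonFrmFrom₁` is CLOSED, «SkelFrmFrom1HoldsAll», untouched here).  Lane `prim-bschramm`, seat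
`prim-bschramm-p3` gen 27 (design owner; (R)-column pen by RULING Us-R3); helper file (`--supports stmt-CriticalPhenomena-4575 --as helper`); NON-VERBATIM GEN row
(hunk class 'h1 ↦ proxy package' of WAVE-Us-MANIFEST §2 + the kit classes (k)/(k2) of design notes K-1/K-2; FULL census): the proof text is «SkelFrmFrom1RootHoldsQC»
:72–:264 with exactly these hunks — (i) binder `(h1 : Φ.types = {t})` ↦ `{D : ℕ} (hP : Φ.HasProxies t D)` + the width floors `hnL : D ≤ n_L`, `hnK : D ≤ n_kit mk`,
`hDM : D ≤ M_u` (C-4; discharged at the top by gen-1's «SkelFrmFromBChoiceDefsVPx» `D_le_nL/nKit/Mu_of_atQ3VPx`); (iii) the zone family `O.merged.Λ · (M_u)` ↦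
`O.merged.Λ (hP.prox ·) (M_u)` (centred / connected from the centre by «SkelFrmFromBChoiceZonePx» `hcz_of_atQPx` / `hzconn_of_atQPx`; inside the radius-`RK mk + D`
kit parallelogram by «SkelFrmFromBChoiceZoneKPx» `hΛRg_of_atQPx`, PRISM form) in the hypotheses `hbridge`, `hDm` and in the two φ-level calls; (iv) the long links
`hlong/hlongY_of_atQ3` ↦ «SkelFrmFromBChoiceLinksPx» `…Px` at radius `RL + D`, hence `RL ↦ RL + D` in `hr₀R`, `hRL5`, `hRLc`, `hhopB`, `hR₁r` and the hop;
(k)/(k2) THE KIT RECORD / RAISED KIT INDEX: the φ-level lemma `Skelφ.rootChainF_of_bridgeSchedC` binds ONE radius `Rs` for the short region (`hRg`) and for the (S0)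
kits' shell/reach rows (equalities of `KS0.kit0`), so under proxies the apron kits, their counts/levels, `R′ = KS0.R'0`, `KS0.r₀0`, `KS.KCmax` and the seed depth
`KS.Rs` are read at `(Dk, mkP)` — a free kit record and kit index tied to the served region by `hRK : KS.RK t O.merged mk + D ≤ KS.RK t Dk mkP` — and the kits'
level offsets at `Mu Dk`; every kit row used is the LANDED row at `(Dk, mkP)` (no new definition, no `+ D` twin of any Params row); the served region, the
kit-pair width and the kit frame `KS.φK … mk` stay at `(O, mk)`.  Instances: K-1 `(Dk, mkP) := (O.merged.bumpR D, mk)` («SkelFrmFromBParamsKitBump» §3,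
gen-1's (C) column), K-2 `(Dk, mkP) := (O.merged, KS.RK t O.merged mk + D)` (ibid. §4 `RK_add_le_RK_raise_of_atQ`; the (R) column's bridge rows).
Everything else — cells, windows, schedule, bridge binders, corridor rows, rooms, rim device, conclusion — is token-identical to the U twin.
[cite: KozmaNitzan2024, §4 p. 28 ((32) at the root); §4 pp. 19–21] [cite: BenjaminiSchramm1996, Conj. 4] [this work]
-/

noncomputable section

open MeasureTheory ProbabilityTheory
open scoped ENNReal Classical

namespace Summit.CriticalPhenomena.PercolationContinuityZ3.Theorems

namespace Transplant

open Literature.Probability.Percolation Literature.Probability.LatticeModels SimpleGraph KNCells KNLevels ChainPlanar ChainPara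
open Literature.Probability.Percolation.KozmaNitzan.Cells (oth sgOf)
open Literature.Barriers.CriticalPhenomena (graphBall graphBall_mono mem_graphBall_self)
open SkelConc (Consts)
open Skel (winGraph)
open SkelI (tanOff)
open Skelφ (rootFrame RootFootS TargetFootS pgSideHalfW)
open ChainPlanar (ScheduleNP BridgePrm BridgeOK)
open Skelφ.StepI (OutNS)

namespace PlanarSkeletonFrmFrom

namespace NegB

open Neg

variable {κ : Consts} {V : Type} [DecidableEq V] [Countable V] {G : SimpleGraph V} [G.LocallyFinite] {Φ : PlanarSkeletonFrmFrom G} {t : V} {p : unitInterval}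
  {hC : Φ.CylSubcritical p} {gv fv : Neg.FSlot} {Pv : PSlot} {Sv : SSlot} {cv : CSlot} {bv : BSlot} {O : OutNS V} {q : unitInterval}

set_option maxHeartbeats 1600000 in
/-- **THE FIRST-AXIS ROOT LEG AT THE CHOICE FUNCTION OF RECORD, UNDER PROXIES** — GEN twin of `rootLegAt_frmQ3C_fst` («SkelFrmFrom1RootHoldsQC»,
skeleton v3: hop → bridge → K-G corridor): the one-type hypothesis is replaced by `hP : Φ.HasProxies t D`; the zone family is `Λ ∘ prox` (served at the
proxy, consumed at the centre), the long links and the hop prism have radius `RL + D` («SkelFrmFromBChoiceLinksPx»), the short kit-route region about `c`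
is the kit parallelogram of radius `RK mk + D` («SkelFrmFromBChoiceZoneKPx»), and the (S0) apron kits, their counts, the reach `R′ = R'0`, `r₀0` and the
seed depth `Rs` are read at a KIT RECORD `Dk` and KIT INDEX `mkP` with `hRK : RK(O.merged, mk) + D ≤ RK(Dk, mkP)` — K-1 users take `(O.merged.bumpR D, mk)`,
K-2 users `(O.merged, RK mk + D)` («SkelFrmFromBParamsKitBump» §4); every kit row is the landed one at `(Dk, mkP)`, no new numerics; the width floors
`D ≤ n_L`, `D ≤ n_kit`, `D ≤ M_u` are explicit (C-4).  Conclusion: the root-leg residue at the centre's own cells, verbatim.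
[cite: KozmaNitzan2024, §4 p. 28 ((32) at the root)] -/
theorem rootLegAt_frmQ3C_fstPx {κ : Consts} {V : Type} [DecidableEq V] [Countable V] {G : SimpleGraph V} [G.LocallyFinite] {Φ : PlanarSkeletonFrmFrom G} {t : V} {p : unitInterval} {hC : Φ.CylSubcritical p} {gv : Neg.FSlot} {fv : Neg.FSlot} {Pv : PSlot} {Sv : SSlot} {cv : CSlot} {bv : BSlot} {O : OutNS V} {q : unitInterval} (Lf : ℕ → ℕ) (hAt : (choiceAtQ3 κ Φ t p Pv gv fv Sv cv bv hC).AtQNQ O q) {D : ℕ} (hP : Φ.HasProxies t D)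
    (hp0 : 0 < (p : ℝ)) (hp1 : (p : ℝ) < 1) (mk : ℕ)
    -- UNDER PROXIES: the width floors (C-4) and THE KIT RECORD / RAISED KIT INDEX (K-1/K-2): apron kits, counts, `R′ = R'0`, `r₀0`, `Rs` are read at `(Dk, mkP)`
    (hnL : D ≤ nL κ Φ t p O.merged (gOf κ Φ t p O gv) (fOf κ Φ t p O fv)) (hnK : D ≤ KS.nKit O.merged mk) (hDM : D ≤ Mu O.merged)
    (Dk : Skelφ.StepI.DataNS V) (mkP : ℕ) (hRK : KS.RK t O.merged mk + D ≤ KS.RK t Dk mkP)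
    -- the corridor of record: ONE row set at `R′ := KS0.R'0 … Dk mkP` (the kit record / raised index) and a run length (stmt-g20 `kgRows0_of`/`kgYRows0_of`, `kgNv0`/`kgNYv0`)
    {ρ qq W : ℕ} (HK : Skelφ.KGRows (nL κ Φ t p O.merged (gOf κ Φ t p O gv) (fOf κ Φ t p O fv)) (ℓL κ Φ t p O.merged (gOf κ Φ t p O gv) (fOf κ Φ t p O fv)) (hL κ Φ t p O.merged (gOf κ Φ t p O gv) (fOf κ Φ t p O fv)) (vL κ Φ t p O.merged (gOf κ Φ t p O gv) (fOf κ Φ t p O fv)) (KS0.R'0 κ Φ t p Dk mkP) ρ qq W) (N : ℕ)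
    -- the window radius about the root: above both kits' late thresholds, below the four concentric radii; the seed radius rows
    {Rπ Rb : ℕ} (hr₀R : KS0.r₀0 t Dk mkP (RL κ Φ t p O gv fv + D) ≤ Rπ) (hr₀bR : KS0.r₀0 t Dk mkP Rb ≤ Rπ)
    (hRQ : Rπ + 1 ≤ ((schedOfS κ Φ t p O.merged (gOf κ Φ t p O gv) (fOf κ Φ t p O fv) (cOf κ Φ t p O gv fv cv) (Sv κ Φ t p O.merged (gOf κ Φ t p O gv) (fOf κ Φ t p O fv) q))).rQ 0 0) (hRB : Rπ + 1 ≤ ((schedOfS κ Φ t p O.merged (gOf κ Φ t p O gv) (fOf κ Φ t p O fv) (cOf κ Φ t p O gv fv cv) (Sv κ Φ t p O.merged (gOf κ Φ t p O gv) (fOf κ Φ t p O fv) q))).rB 0 0 (((0 : Fin 2), true) : MDir))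
    (hRQ' : Rπ + 1 ≤ ((schedOfS κ Φ t p O.merged (gOf κ Φ t p O gv) (fOf κ Φ t p O fv) (cOf κ Φ t p O gv fv cv) (Sv κ Φ t p O.merged (gOf κ Φ t p O gv) (fOf κ Φ t p O fv) q))).rQ 0 ((0 : Site 2) + stepVec (((0 : Fin 2), true) : MDir))) (hRM : Rπ + 1 ≤ ((schedOfS κ Φ t p O.merged (gOf κ Φ t p O gv) (fOf κ Φ t p O fv) (cOf κ Φ t p O gv fv cv) (Sv κ Φ t p O.merged (gOf κ Φ t p O gv) (fOf κ Φ t p O fv) q))).rM 0 ((0 : Site 2) + stepVec (((0 : Fin 2), true) : MDir)))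
    (hRsR : KS.Rs t Dk mkP ≤ Rπ) (hRs5 : ∀ i, KS.Rs t Dk mkP + 1 ≤ 5 * ((fcellsS κ Φ t p O.merged (gOf κ Φ t p O gv) (fOf κ Φ t p O fv) (cOf κ Φ t p O gv fv cv))).r i)
    -- the hop's prism rows (`∥ := 0`, `⊥ := 1`)
    (hRL5 : (RL κ Φ t p O gv fv + D) + 1 ≤ 5 * ((fcellsS κ Φ t p O.merged (gOf κ Φ t p O gv) (fOf κ Φ t p O fv) (cOf κ Φ t p O gv fv cv))).r 0) (hRLc : ((RL κ Φ t p O gv fv + D) : ℤ) + 2 + ((fcellsS κ Φ t p O.merged (gOf κ Φ t p O gv) (fOf κ Φ t p O fv) (cOf κ Φ t p O gv fv cv))).c 0 ≤ 5 * ((fcellsS κ Φ t p O.merged (gOf κ Φ t p O gv) (fOf κ Φ t p O fv) (cOf κ Φ t p O gv fv cv))).r 1)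
    -- the landing vertex and the depth row ((R-37): `c₁` over the lattice point putting the bridge landing at the back end of core 0)
    (c₁ : V) {D₀ : ℕ} (hc₁ : c₁ ∈ graphBall G t D₀)
    (hRD : (D₀ : ℤ) +
      (10 + 3) * (((N : ℤ) + 1) * (nL κ Φ t p O.merged (gOf κ Φ t p O gv) (fOf κ Φ t p O fv)) + Skelφ.kgZ₀ (nL κ Φ t p O.merged (gOf κ Φ t p O gv) (fOf κ Φ t p O fv)) (vL κ Φ t p O.merged (gOf κ Φ t p O gv) (fOf κ Φ t p O fv)) (KS0.R'0 κ Φ t p Dk mkP) ρ qq N (Skelφ.kgM₁ (nL κ Φ t p O.merged (gOf κ Φ t p O gv) (fOf κ Φ t p O fv)) (ℓL κ Φ t p O.merged (gOf κ Φ t p O gv) (fOf κ Φ t p O fv)) (hL κ Φ t p O.merged (gOf κ Φ t p O gv) (fOf κ Φ t p O fv)) (KS0.R'0 κ Φ t p Dk mkP) ρ W N) (Skelφ.kgM₂ (nL κ Φ t p O.merged (gOf κ Φ t p O gv) (fOf κ Φ t p O fv)) (ℓL κ Φ t p O.merged (gOf κ Φ t p O gv) (fOf κ Φ t p O fv)) (hL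 κ Φ t p O.merged (gOf κ Φ t p O gv) (fOf κ Φ t p O fv)) (vL κ Φ t p O.merged (gOf κ Φ t p O gv) (fOf κ Φ t p O fv)) (KS0.R'0 κ Φ t p Dk mkP) ρ qq W N) +
        Skelφ.kgZ₁ (nL κ Φ t p O.merged (gOf κ Φ t p O gv) (fOf κ Φ t p O fv)) (ℓL κ Φ t p O.merged (gOf κ Φ t p O gv) (fOf κ Φ t p O fv)) (hL κ Φ t p O.merged (gOf κ Φ t p O gv) (fOf κ Φ t p O fv)) (KS0.R'0 κ Φ t p Dk mkP) ρ W N (Skelφ.kgM₁ (nL κ Φ t p O.merged (gOf κ Φ t p O gv) (fOf κ Φ t p O fv)) (ℓL κ Φ t p O.merged (gOf κ Φ t p O gv) (fOf κ Φ t p O fv)) (hL κ Φ t p O.merged (gOf κ Φ t p O gv) (fOf κ Φ t p O fv)) (KS0.R'0 κ Φ t p Dk mkP) ρ W N) (Skelφ.kgWm₂ (nL κ Φ t p O.merged (gOf κ Φ t p O gv) (fOf κ Φ t p O fv)) (ℓL κ Φ t p O.merged (gOf κ Φ t p O gv) (fOf κ Φ t p O fv)) (hL κ Φ t p O.merged (gOf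 κ Φ t p O gv) (fOf κ Φ t p O fv)) (KS0.R'0 κ Φ t p Dk mkP) ρ W N) (Skelφ.kgWp₂ (nL κ Φ t p O.merged (gOf κ Φ t p O gv) (fOf κ Φ t p O fv)) (ℓL κ Φ t p O.merged (gOf κ Φ t p O gv) (fOf κ Φ t p O fv)) (hL κ Φ t p O.merged (gOf κ Φ t p O gv) (fOf κ Φ t p O fv)) (KS0.R'0 κ Φ t p Dk mkP) ρ W N) (Skelφ.kgM₂ (nL κ Φ t p O.merged (gOf κ Φ t p O gv) (fOf κ Φ t p O fv)) (ℓL κ Φ t p O.merged (gOf κ Φ t p O gv) (fOf κ Φ t p O fv)) (hL κ Φ t p O.merged (gOf κ Φ t p O gv) (fOf κ Φ t p O fv)) (vL κ Φ t p O.merged (gOf κ Φ t p O gv) (fOf κ Φ t p O fv)) (KS0.R'0 κ Φ t p Dk mkP) ρ qq W N)) ≤ Rπ)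
    -- THE BRIDGE (stmt-g20 port of N1's `KS.BFs/BFd/BFt`, `bridgeData_*` over `inputsExtraAt_of_atQ`): frame, hop box = `B₀`, `R′`, core-1 box rows, seed
    -- clearance (R-F1), readings in the root frame at reach radius `Rb`, THE BRIDGE EVENT at accuracy `(κ.δr 0)³`
    (B : BridgePrm) (hB : BridgeOK B) (hB0 : B.B₀lo ≤ B.B₀hi) (hBR' : KS0.R'0 κ Φ t p Dk mkP ≤ B.R')
    (hc1 : B.core1Lo ≤ B.core1Hi) (hc1R : (B.core1Lo 0).natAbs + (B.core1Lo 1).natAbs ≤ Rπ)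
    (hhopB : ∀ w ∈ pgSideHalfW G (φL κ Φ t p O.D O.DT.toDataN O.ori (gOf κ Φ t p O gv) (fOf κ Φ t p O fv)) t (nL κ Φ t p O.merged (gOf κ Φ t p O gv) (fOf κ Φ t p O fv)) (hL κ Φ t p O.merged (gOf κ Φ t p O gv) (fOf κ Φ t p O fv)) (ℓL κ Φ t p O.merged (gOf κ Φ t p O gv) (fOf κ Φ t p O fv)) (RL κ Φ t p O gv fv + D) 1 (1 * 1), rootFrame (φL κ Φ t p O.D O.DT.toDataN O.ori (gOf κ Φ t p O gv) (fOf κ Φ t p O fv)) t 1 w ∈ Finset.Icc B.B₀lo B.B₀hi)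
    (hclear₁ : (KS.Rs t Dk mkP : ℤ) < B.B₀lo 0 - B.R' - B.pr)
    (Qb Fb : V → Finset V)
    (hQb : ∀ c, ∀ w ∈ Qb c, w ∈ graphBall G c Rb ∧
      rootFrame (φL κ Φ t p O.D O.DT.toDataN O.ori (gOf κ Φ t p O gv) (fOf κ Φ t p O fv)) t 1 w ∈ Finset.Icc (rootFrame (φL κ Φ t p O.D O.DT.toDataN O.ori (gOf κ Φ t p O gv) (fOf κ Φ t p O fv)) t 1 c - ((B.pr : ℕ) : Site 2)) (rootFrame (φL κ Φ t p O.D O.DT.toDataN O.ori (gOf κ Φ t p O gv) (fOf κ Φ t p O fv)) t 1 c + ((B.pr : ℕ) : Site 2)))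
    (hFb : ∀ c, ∀ w ∈ Fb c, w ∈ Qb c ∧ rootFrame (φL κ Φ t p O.D O.DT.toDataN O.ori (gOf κ Φ t p O gv) (fOf κ Φ t p O fv)) t 1 w ∈ Finset.Icc (rootFrame (φL κ Φ t p O.D O.DT.toDataN O.ori (gOf κ Φ t p O gv) (fOf κ Φ t p O fv)) t 1 c + B.dlo) (rootFrame (φL κ Φ t p O.D O.DT.toDataN O.ori (gOf κ Φ t p O gv) (fOf κ Φ t p O fv)) t 1 c + B.dhi))
    (hbridge : ∀ c, 1 - κ.δr 0 ^ 3 < (bondPercolation G q).real (linkIn (↑(Qb c) : Set V) (O.merged.Λ (hP.prox c) (Mu O.merged)) (Fb c)))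
    -- ROOM ROWS at the root cell (hp-8 g40 RootRoomsS / p5-g16 readings): footprints, corridor clearance, the cross link, the planar diameter of the cut world
    (hfoot₁ : ∀ w ∈ graphBall G t Rπ, rootFrame (φL κ Φ t p O.D O.DT.toDataN O.ori (gOf κ Φ t p O gv) (fOf κ Φ t p O fv)) t 1 w ∈ Finset.Icc B.regionLo B.regionHi → RootFootS (fcellsS κ Φ t p O.merged (gOf κ Φ t p O gv) (fOf κ Φ t p O fv) (cOf κ Φ t p O gv fv cv)) (((0 : Fin 2), true) : MDir) ((fineOA κ Φ t p O.D O.DT.toDataN O.ori (gOf κ Φ t p O gv) (fOf κ Φ t p O fv)) w))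
    (hfoot₂ : ∀ k ≤ (Skelφ.kgCorrSched (HK.kgVals_ok₁ N) (HK.kgVals_ok₂ N) (HK.kgVals_split N)).N, ∀ w ∈ graphBall G t Rπ, Skelφ.runX (φL κ Φ t p O.D O.DT.toDataN O.ori (gOf κ Φ t p O gv) (fOf κ Φ t p O fv)) c₁ (nL κ Φ t p O.merged (gOf κ Φ t p O gv) (fOf κ Φ t p O fv)) (hL κ Φ t p O.merged (gOf κ Φ t p O gv) (fOf κ Φ t p O fv)) 1 w ∈ (Skelφ.kgCorrSched (HK.kgVals_ok₁ N) (HK.kgVals_ok₂ N) (HK.kgVals_split N)).region k → RootFootS (fcellsS κ Φ t p O.merged (gOf κ Φ t p O gv) (fOf κ Φ t p O fv) (cOf κ Φ t p O gv fv cv)) (((0 : Fin 2), true) : MDir) ((fineOA κ Φ t p O.D O.DT.toDataN O.ori (gOf κ Φ t p O gv) (fOf κ Φ t p O fv)) w))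
    (hlastf : ∀ w ∈ graphBall G t Rπ, Skelφ.runX (φL κ Φ t p O.D O.DT.toDataN O.ori (gOf κ Φ t p O gv) (fOf κ Φ t p O fv)) c₁ (nL κ Φ t p O.merged (gOf κ Φ t p O gv) (fOf κ Φ t p O fv)) (hL κ Φ t p O.merged (gOf κ Φ t p O gv) (fOf κ Φ t p O fv)) 1 w ∈ ScheduleNP.core (Skelφ.kgCorrSched (HK.kgVals_ok₁ N) (HK.kgVals_ok₂ N) (HK.kgVals_split N)) ((Skelφ.kgCorrSched (HK.kgVals_ok₁ N) (HK.kgVals_ok₂ N) (HK.kgVals_split N)).N + 1) → TargetFootS (fcellsS κ Φ t p O.merged (gOf κ Φ t p O gv) (fOf κ Φ t p O fv) (cOf κ Φ t p O gv fv cv)) (bOf κ Φ t p O gv fv bv) (((0 : Fin 2), true) : MDir) ((fineOA κ Φ t p O.D O.DT.toDataN O.ori (gOf κ Φ t p O gv) (fOf κ Φ t p O fv)) w))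
    (hnR : (KS0.R'0 κ Φ t p Dk mkP) ≤ (nL κ Φ t p O.merged (gOf κ Φ t p O gv) (fOf κ Φ t p O fv))) (hrow : (qq : ℤ) + (N + 1) * (KS0.R'0 κ Φ t p Dk mkP) + (((Skelφ.kgM₁ (nL κ Φ t p O.merged (gOf κ Φ t p O gv) (fOf κ Φ t p O fv)) (ℓL κ Φ t p O.merged (gOf κ Φ t p O gv) (fOf κ Φ t p O fv)) (hL κ Φ t p O.merged (gOf κ Φ t p O gv) (fOf κ Φ t p O fv)) (KS0.R'0 κ Φ t p Dk mkP) ρ W N) : ℤ) + 1) * ((KS0.R'0 κ Φ t p Dk mkP) + ρ + |(vL κ Φ t p O.merged (gOf κ Φ t p O gv) (fOf κ Φ t p O fv))|) + (nL κ Φ t p O.merged (gOf κ Φ t p O gv) (fOf κ Φ t p O fv)) ≤ ((N : ℤ) + 1) * (nL κ Φ t p O.merged (gOf κ Φ t p O gv) (fOf κ Φ t p O fv)))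
    (hX₁ : (KS.Rs t Dk mkP : ℤ) + qq + (KS0.R'0 κ Φ t p Dk mkP) + (nL κ Φ t p O.merged (gOf κ Φ t p O gv) (fOf κ Φ t p O fv)) < (φL κ Φ t p O.D O.DT.toDataN O.ori (gOf κ Φ t p O gv) (fOf κ Φ t p O fv)) c₁ 0 - (φL κ Φ t p O.D O.DT.toDataN O.ori (gOf κ Φ t p O gv) (fOf κ Φ t p O fv)) t 0)
    (hx : ∀ w ∈ graphBall G t Rπ, rootFrame (φL κ Φ t p O.D O.DT.toDataN O.ori (gOf κ Φ t p O gv) (fOf κ Φ t p O fv)) t 1 w ∈ Finset.Icc B.core1Lo B.core1Hi → Skelφ.runX (φL κ Φ t p O.D O.DT.toDataN O.ori (gOf κ Φ t p O gv) (fOf κ Φ t p O fv)) c₁ (nL κ Φ t p O.merged (gOf κ Φ t p O gv) (fOf κ Φ t p O fv)) (hL κ Φ t p O.merged (gOf κ Φ t p O gv) (fOf κ Φ t p O fv)) 1 w ∈ ScheduleNP.core (Skelφ.kgCorrSched (HK.kgVals_ok₁ N) (HK.kgVals_ok₂ N) (HK.kgVals_split N)) 0)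
    {φe : V → Site 2} {m R₁ : ℕ}
    (hDm : ∀ d ∈ ((((KSchA.mk (ΓQ κ Φ t p O gv fv Sv cv bv q) q κ.δ : KSchA V ℕ)).U0root (((0 : Fin 2), true) : MDir)).filter fun y => y ∈ graphBall G t Rπ) \ O.merged.Λ (hP.prox t) (Mu O.merged),
      ∀ d' ∈ ((((KSchA.mk (ΓQ κ Φ t p O gv fv Sv cv bv q) q κ.δ : KSchA V ℕ)).U0root (((0 : Fin 2), true) : MDir)).filter fun y => y ∈ graphBall G t Rπ) \ O.merged.Λ (hP.prox t) (Mu O.merged), φe d - φe d' ∈ box 2 m)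
    -- THE RIM-EXCESS DEVICE at the root (stmt SlotsS), at `κ.δr 0 / 2`, entrance depth `Rs + 1`, below both kits' rims
    (hR₁ : ∀ R'', R₁ ≤ R'' → ∀ (Rw : ℕ) (D' B' : Finset V), (∀ d ∈ D', d ∈ graphBall G t Rw) →
      (∀ d ∈ D', ∀ d' ∈ D', φe d - φe d' ∈ box 2 m) → B' ⊆ D' → (∀ a ∈ B', a ∈ graphBall G t (KS.Rs t Dk mkP + 1)) →
        (bondPercolation G q).real (Skel.excess G t R'' D' B') ≤ κ.δr 0 / 2)
    (hR₁b : R₁ ≤ Rπ - KS0.r₀0 t Dk mkP Rb) (hR₁r : R₁ ≤ Rπ - KS0.r₀0 t Dk mkP (RL κ Φ t p O gv fv + D))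
    -- THE LENGTH ROW (stmt `kgSchedN_le_LfQ`: `N_corridor + 1 ≤ LfQ`; the bridge is the `+1`)
    (hlen : (B.bridgeFrame hB).N + 1 + (Skelφ.kgCorrSched (HK.kgVals_ok₁ N) (HK.kgVals_ok₂ N) (HK.kgVals_split N)).toFrame.N ≤ Lf κ.K₀) :
    ∃ n, n ≤ Lf κ.K₀ ∧ ∃ (c : V) (Rπ : ℕ) (W : Sym2 V → unitInterval) (s : Fin (n + 1) → KNLevels.TStep (winGraph G c Rπ))
      (T' : Fin (n + 1) → Finset V) (η' : ℝ),
      (∀ T : Finset V, (prodBernoulli W).real (⋃ t' ∈ T, openConn (ΓQ κ Φ t p O gv fv Sv cv bv q).root t') ≤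
        (prodBernoulli (pinW (KNLevels.lattW G q) ↑((⟨ΓQ κ Φ t p O gv fv Sv cv bv q, q, κ.δ⟩ : KSchA V ℕ).U₀ G)
          ↑((⟨ΓQ κ Φ t p O gv fv Sv cv bv q, q, κ.δ⟩ : KSchA V ℕ).U₀ G))).real
          (⋃ t' ∈ (↑T : Set V), openConnIn (↑((ΓQ κ Φ t p O gv fv Sv cv bv q).Q (ΓQ κ Φ t p O gv fv Sv cv bv q).a₀ 0 ∪
            (ΓQ κ Φ t p O gv fv Sv cv bv q).Ewv (ΓQ κ Φ t p O gv fv Sv cv bv q).a₀ 0 (((0 : Fin 2), true) : MDir)) : Set V)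
            (ΓQ κ Φ t p O gv fv Sv cv bv q).root t')) ∧
      (∀ i : Fin (n + 1), (s i).L.o = (ΓQ κ Φ t p O gv fv Sv cv bv q).root) ∧
      (∀ i : Fin n, T' (Fin.castSucc i) ⊆ (s i.succ).L.X 0) ∧ (∀ i : Fin (n + 1), T' i ⊆ (s i).T) ∧
      (∀ i : Fin (n + 1), (s i).KitsAtF W q Φ.Δ (κ.δr 0)) ∧ η' ≤ κ.δr 0 / 2 ∧
      (∀ i : Fin (n + 1), (prodBernoulli W).real (⋃ t' ∈ (s i).T \ T' i, openConn (ΓQ κ Φ t p O gv fv Sv cv bv q).root t') ≤ η') ∧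
      1 - κ.δr 0 < (prodBernoulli W).real (s 0).L.reachB ∧
      T' (Fin.last n) ⊆ (ΓQ κ Φ t p O gv fv Sv cv bv q).M (ΓQ κ Φ t p O gv fv Sv cv bv q).a₀ ((0 : Site 2) + stepVec (((0 : Fin 2), true) : MDir)) := by
  -- facts at `AtQNQ`
  have hEq : EqNumL κ Φ t p O.merged (gOf κ Φ t p O gv) (fOf κ Φ t p O fv) := eqNumL_of_atQ hAt
  obtain ⟨hn1, hℓ1⟩ := one_le_of_eqNumL κ Φ t p O.merged (gOf κ Φ t p O gv) (fOf κ Φ t p O fv) hEq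
  have hκL := (clauseL_of_atQ hAt).2
  obtain ⟨-, hq1, hq2, -⟩ := factsNS_of_atQ hAt
  have hδ0 : 0 < κ.δr 0 := (κ.hδr 0).1
  have hδ1 : κ.δr 0 ≤ 1 := (κ.hδr 0).2
  have hkit : Neg.δkit κ Φ ≤ κ.δr 0 := Neg.δkit_le_δr κ Φ (n := 0) (by norm_num)
  have hlipφ := lip_φL κ Φ t p O.D O.DT.toDataN O.ori (gOf κ Φ t p O gv) (fOf κ Φ t p O fv)
  have hstepφ := steps_φL κ Φ t p O.D O.DT.toDataN O.ori (gOf κ Φ t p O gv) (fOf κ Φ t p O fv)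
  -- the zone UNDER PROXIES (`Λ ∘ prox` at `M_u`): centred, connected from the centre («SkelFrmFromBChoiceZonePx»)
  have hcz := hcz_of_atQPx hAt hP hDM
  have hzconn := hzconn_of_atQPx hAt hP hDM
  -- the fine map: 1-Lipschitz, weak steps, root at the origin
  have hlipψ := lip_fineA_at κ Φ t p O.merged (gOf κ Φ t p O gv) (fOf κ Φ t p O fv) hlipφ hEq
  have hwsψ := weakSteps_fineA_at κ Φ t p O.merged (gOf κ Φ t p O gv) (fOf κ Φ t p O fv) hstepφ hEq
  have hψ0 := fineA_base_at κ Φ t p O.merged (gOf κ Φ t p O gv) (fOf κ Φ t p O fv) (φL κ Φ t p O.D O.DT.toDataN O.ori (gOf κ Φ t p O gv) (fOf κ Φ t p O fv)) hEq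
  -- the short region UNDER PROXIES: the kit parallelogram about `c` at radius `RK mk + D` («SkelFrmFromBChoiceZoneKPx» prism form), inside `B(c, Rs(Dk, mkP))`
  -- by `hRK`, of cardinality `≤ cUA(Dk, mkP)`; the seed := the zone at the root: depth `Rs(Dk, mkP)`, footprint, along-coordinate bound
  have hRg : ∀ c, ∀ u ∈ Skelφ.pgramPrismFin G (KS.φK Φ t O.D O.DT.toDataN O.ori mk) c (KS.nKit O.merged mk) (KS.hKit t O.merged mk) (3 * KS.ℓKit t O.merged mk)
      (KS.RK t O.merged mk + D), u ∈ graphBall G c (KS.Rs t Dk mkP) := fun c u hu =>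
    graphBall_mono G c (hRK.trans (KS.RK_le_Rs t Dk mkP).1)
      (Skelφ.cylBall_subset_prism G (KS.φK Φ t O.D O.DT.toDataN O.ori mk) c _ _ ((Skelφ.mem_pgramPrismFin G (KS.φK Φ t O.D O.DT.toDataN O.ori mk)).1 hu).1).1
  have hRgcard : ∀ c, (Skelφ.pgramPrismFin G (KS.φK Φ t O.D O.DT.toDataN O.ori mk) c (KS.nKit O.merged mk) (KS.hKit t O.merged mk) (3 * KS.ℓKit t O.merged mk)
      (KS.RK t O.merged mk + D)).card ≤ KS.cUA Φ t Dk mkP := fun c => by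
    classical
    refine le_trans (Finset.card_le_card fun v hv => ?_) ((Skelφ.card_cylBallFin_le (φ := KS.φK Φ t O.D O.DT.toDataN O.ori mk) Φ.degree_le c
      (Skelφ.pgScale (KS.nKit O.merged mk) (KS.hKit t O.merged mk) (3 * KS.ℓKit t O.merged mk)) (KS.RK t O.merged mk + D)).trans
      (Nat.pow_le_pow_right (Nat.succ_pos _) hRK))
    rw [Skelφ.mem_cylBallFin]
    exact ((Skelφ.mem_pgramPrismFin G (KS.φK Φ t O.D O.DT.toDataN O.ori mk)).1 hv).1
  have hΛRg : ∀ c, O.merged.Λ (hP.prox c) (Mu O.merged) ⊆ Skelφ.pgramPrismFin G (KS.φK Φ t O.D O.DT.toDataN O.ori mk) c (KS.nKit O.merged mk) (KS.hKit t O.merged mk) (3 * KS.ℓKit t O.merged mk)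
      (KS.RK t O.merged mk + D) := fun c a ha =>
    (Skelφ.mem_pgramPrismFin G (KS.φK Φ t O.D O.DT.toDataN O.ori mk)).2 (hΛRg_of_atQPx mk hAt hP hnK c (Finset.mem_coe.2 ha))
  have hZρ : ∀ u ∈ O.merged.Λ (hP.prox t) (Mu O.merged), u ∈ graphBall G t (KS.Rs t Dk mkP) := fun u hu => hRg t u (hΛRg t hu)
  have hψabs : ∀ {n : ℕ}, ∀ u ∈ graphBall G t n, ∀ i, |fineA κ Φ t p O.merged (gOf κ Φ t p O gv) (fOf κ Φ t p O fv) (φL κ Φ t p O.D O.DT.toDataN O.ori (gOf κ Φ t p O gv) (fOf κ Φ t p O fv)) u i| ≤ (n : ℤ) := by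
    intro n u hu i
    have h := Skelφ.abs_sub_le_of_mem_graphBall hlipψ hu i
    rwa [hψ0, Pi.zero_apply, sub_zero] at h
  have hZfoot : ∀ a ∈ O.merged.Λ (hP.prox t) (Mu O.merged),
      -(5 * (((fcellsS κ Φ t p O.merged (gOf κ Φ t p O gv) (fOf κ Φ t p O fv) (cOf κ Φ t p O gv fv cv))).r (((0 : Fin 2), true) : MDir).1 : ℤ)) + 1 ≤ sgOf (((0 : Fin 2), true) : MDir) * fineA κ Φ t p O.merged (gOf κ Φ t p O gv) (fOf κ Φ t p O fv) (φL κ Φ t p O.D O.DT.toDataN O.ori (gOf κ Φ t p O gv) (fOf κ Φ t p O fv)) a (((0 : Fin 2), true) : MDir).1 ∧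
      sgOf (((0 : Fin 2), true) : MDir) * fineA κ Φ t p O.merged (gOf κ Φ t p O gv) (fOf κ Φ t p O fv) (φL κ Φ t p O.D O.DT.toDataN O.ori (gOf κ Φ t p O gv) (fOf κ Φ t p O fv)) a (((0 : Fin 2), true) : MDir).1 ≤ 5 * (((fcellsS κ Φ t p O.merged (gOf κ Φ t p O gv) (fOf κ Φ t p O fv) (cOf κ Φ t p O gv fv cv))).r (((0 : Fin 2), true) : MDir).1 : ℤ) ∧
      |fineA κ Φ t p O.merged (gOf κ Φ t p O gv) (fOf κ Φ t p O fv) (φL κ Φ t p O.D O.DT.toDataN O.ori (gOf κ Φ t p O gv) (fOf κ Φ t p O fv)) a (oth (((0 : Fin 2), true) : MDir).1)| ≤ 5 * (((fcellsS κ Φ t p O.merged (gOf κ Φ t p O gv) (fOf κ Φ t p O fv) (cOf κ Φ t p O gv fv cv))).r (oth (((0 : Fin 2), true) : MDir).1) : ℤ) - 1 :=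
    fun a ha => Skelφ.seedFootS_of_abs_le (fcellsS κ Φ t p O.merged (gOf κ Φ t p O gv) (fOf κ Φ t p O fv) (cOf κ Φ t p O gv fv cv)) (((0 : Fin 2), true) : MDir) (hψabs a (hZρ a ha)) hRs5
  have hZk : ∀ a ∈ O.merged.Λ (hP.prox t) (Mu O.merged), |rootFrame (φL κ Φ t p O.D O.DT.toDataN O.ori (gOf κ Φ t p O gv) (fOf κ Φ t p O fv)) t 1 a 0| ≤ (KS.Rs t Dk mkP : ℤ) := fun a ha => by
    have h := Skelφ.abs_sub_le_of_mem_graphBall hlipφ (hZρ a ha) 0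
    have hrf : rootFrame (φL κ Φ t p O.D O.DT.toDataN O.ori (gOf κ Φ t p O gv) (fOf κ Φ t p O fv)) t 1 a 0 = (φL κ Φ t p O.D O.DT.toDataN O.ori (gOf κ Φ t p O gv) (fOf κ Φ t p O fv)) a 0 - (φL κ Φ t p O.D O.DT.toDataN O.ori (gOf κ Φ t p O gv) (fOf κ Φ t p O fv)) t 0 := by
      show (if (0 : Fin 2) = 0 then (1 : ℤ) * ((φL κ Φ t p O.D O.DT.toDataN O.ori (gOf κ Φ t p O gv) (fOf κ Φ t p O fv)) a 0 - (φL κ Φ t p O.D O.DT.toDataN O.ori (gOf κ Φ t p O gv) (fOf κ Φ t p O fv)) t 0) else (φL κ Φ t p O.D O.DT.toDataN O.ori (gOf κ Φ t p O gv) (fOf κ Φ t p O fv)) a 1 - (φL κ Φ t p O.D O.DT.toDataN O.ori (gOf κ Φ t p O gv) (fOf κ Φ t p O fv)) t 1) = _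
      rw [if_pos rfl, one_mul]
    rw [hrf]; exact h
  -- the two kits at the kit index `mk`: constants, sizes, thresholds, reach
  obtain ⟨hPN, hdD, hDρ, hKCmax, hT, -⟩ := KS0.kit0_ok t Dk mkP ((Mu Dk + 1 : ℕ) * (Skelφ.shearUnit (nL κ Φ t p O.merged (gOf κ Φ t p O gv) (fOf κ Φ t p O fv)) (hL κ Φ t p O.merged (gOf κ Φ t p O gv) (fOf κ Φ t p O fv)) : ℤ) + 1)
    (KS0.r₀0 t Dk mkP (RL κ Φ t p O gv fv + D)) (kq := 10) le_rfl
  obtain ⟨hrs, hcS⟩ := KS0.kit0_sizes Φ t Dk mkP ((Mu Dk + 1 : ℕ) * (Skelφ.shearUnit (nL κ Φ t p O.merged (gOf κ Φ t p O gv) (fOf κ Φ t p O fv)) (hL κ Φ t p O.merged (gOf κ Φ t p O gv) (fOf κ Φ t p O fv)) : ℤ) + 1) (KS0.r₀0 t Dk mkP (RL κ Φ t p O gv fv + D))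
  obtain ⟨hr₀, -⟩ := KS0.hr₀_kit0 t Dk mkP ((Mu Dk + 1 : ℕ) * (Skelφ.shearUnit (nL κ Φ t p O.merged (gOf κ Φ t p O gv) (fOf κ Φ t p O fv)) (hL κ Φ t p O.merged (gOf κ Φ t p O gv) (fOf κ Φ t p O fv)) : ℤ) + 1) (KS0.r₀0_ge t Dk mkP (RL κ Φ t p O gv fv + D)).1
  have hreach := KS0.hreach_kit0 t Dk mkP ((Mu Dk + 1 : ℕ) * (Skelφ.shearUnit (nL κ Φ t p O.merged (gOf κ Φ t p O gv) (fOf κ Φ t p O fv)) (hL κ Φ t p O.merged (gOf κ Φ t p O gv) (fOf κ Φ t p O fv)) : ℤ) + 1) (KS0.r₀0_ge t Dk mkP (RL κ Φ t p O gv fv + D)).2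
  obtain ⟨-, hdDb, hDρb, hKCmaxb, hTb, hPNb⟩ := KS0.kit0_ok t Dk mkP ((Mu Dk : ℤ) + 2) (KS0.r₀0 t Dk mkP Rb) (kq := 0) (by norm_num)
  obtain ⟨hrsb, hcSb⟩ := KS0.kit0_sizes Φ t Dk mkP ((Mu Dk : ℤ) + 2) (KS0.r₀0 t Dk mkP Rb)
  obtain ⟨hr₀b, -⟩ := KS0.hr₀_kit0 t Dk mkP ((Mu Dk : ℤ) + 2) (KS0.r₀0_ge t Dk mkP Rb).1
  have hreachb := KS0.hreach_kit0 t Dk mkP ((Mu Dk : ℤ) + 2) (KS0.r₀0_ge t Dk mkP Rb).2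
  have hRLπ : (RL κ Φ t p O gv fv + D) ≤ Rπ := le_trans (Nat.le_add_right _ _) ((KS0.r₀0_ge t Dk mkP (RL κ Φ t p O gv fv + D)).2.trans hr₀R)
  have hRbπ : Rb ≤ Rπ := le_trans (Nat.le_add_right _ _) ((KS0.r₀0_ge t Dk mkP Rb).2.trans hr₀bR)
  -- the counts at the root accuracy, the levels
  obtain ⟨hk, hcount⟩ := KS0.counts_atq_root κ Φ t p Dk mkP hp0 hp1 hq1 hq2
  have hNk := KS0.hNk0_at κ Φ t p Dk mkP hp0 hp1
  have hreach0 : ∀ (A : ℤ) (r₀ : ℕ), KS0.j₁0 κ Φ t p Dk mkP +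
      ((KS0.kit0 t Dk mkP A r₀).N * (tanOff (KS0.kit0 t Dk mkP A r₀).ℓs (KS0.kit0 t Dk mkP A r₀).M + 1) +
        (KS0.kit0 t Dk mkP A r₀).N * (KS0.kit0 t Dk mkP A r₀).d + KS.KCmax t Dk mkP) ≤ KS0.R'0 κ Φ t p Dk mkP := by
    intro A r₀
    rw [KS0.tanOff_kit0]
    simp only [KS0.kit0]
    have h := (KS0.R'0_eq κ Φ t p Dk mkP).1
    unfold KS0.reach0 at h
    omega
  -- the bridge level-width rows from `B₀lo ≤ B₀hi`, `j ≥ j₀0 = T0 = tanOff`, and the kit constants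
  have hT0 : tanOff (KS0.kit0 t Dk mkP ((Mu Dk : ℤ) + 2) (KS0.r₀0 t Dk mkP Rb)).ℓs (KS0.kit0 t Dk mkP ((Mu Dk : ℤ) + 2) (KS0.r₀0 t Dk mkP Rb)).M = KS0.j₀0 t Dk mkP := KS0.tanOff_kit0 t Dk mkP _ _
  have hwideb : ∀ j, KS0.j₀0 t Dk mkP ≤ j → j ≤ KS0.j₁0 κ Φ t p Dk mkP → ∀ i,
      (B.B₀lo - (j : Site 2)) i + 2 * tanOff (KS0.kit0 t Dk mkP ((Mu Dk : ℤ) + 2) (KS0.r₀0 t Dk mkP Rb)).ℓs (KS0.kit0 t Dk mkP ((Mu Dk : ℤ) + 2) (KS0.r₀0 t Dk mkP Rb)).M ≤ (B.B₀hi + (j : Site 2)) i :=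
    fun j hj0 _ i => Skelφ.icc_level_room hB0 hj0 (by rw [hT0]) i
  have hdwb : ∀ j, KS0.j₀0 t Dk mkP ≤ j → j ≤ KS0.j₁0 κ Φ t p Dk mkP → ∀ i,
      (B.B₀lo - (j : Site 2)) i + ((KS0.kit0 t Dk mkP ((Mu Dk : ℤ) + 2) (KS0.r₀0 t Dk mkP Rb)).d + 2 : ℕ) ≤ (B.B₀hi + (j : Site 2)) i :=
    fun j hj0 _ i => Skelφ.icc_level_room hB0 hj0 (by have h := hTb; rw [hT0] at h; push_cast at h ⊢; omega) i
  have hDwb : ∀ j, KS0.j₀0 t Dk mkP ≤ j → j ≤ KS0.j₁0 κ Φ t p Dk mkP → ∀ i,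
      (B.B₀lo - (j : Site 2)) i + ((Skelφ.shellD (KS0.kit0 t Dk mkP ((Mu Dk : ℤ) + 2) (KS0.r₀0 t Dk mkP Rb)) + 1 + (KS0.kit0 t Dk mkP ((Mu Dk : ℤ) + 2) (KS0.r₀0 t Dk mkP Rb)).d + KS.KCmax t Dk mkP + KS.Rs t Dk mkP : ℕ) : ℤ) ≤ (B.B₀hi + (j : Site 2)) i :=
    fun j hj0 _ i => Skelφ.icc_level_room hB0 hj0 (by have h := hTb; rw [hT0] at h; push_cast at h ⊢; omega) i
  -- the bridge's true target window is nonempty: a frame vertex over the corner `core1Lo`, within the window by `hc1R`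
  have hTne₁ : (Skelφ.Win G (rootFrame (φL κ Φ t p O.D O.DT.toDataN O.ori (gOf κ Φ t p O gv) (fOf κ Φ t p O fv)) t 1) t (Finset.Icc B.core1Lo B.core1Hi) Rπ).Nonempty := by
    obtain ⟨g, hg, hgy⟩ := Skelφ.exists_mem_graphBall_φ_eq hstepφ t ((φL κ Φ t p O.D O.DT.toDataN O.ori (gOf κ Φ t p O gv) (fOf κ Φ t p O fv)) t + B.core1Lo)
    have h0 : ((φL κ Φ t p O.D O.DT.toDataN O.ori (gOf κ Φ t p O gv) (fOf κ Φ t p O fv)) t + B.core1Lo) 0 - (φL κ Φ t p O.D O.DT.toDataN O.ori (gOf κ Φ t p O gv) (fOf κ Φ t p O fv)) t 0 = B.core1Lo 0 := by simp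
    have h1' : ((φL κ Φ t p O.D O.DT.toDataN O.ori (gOf κ Φ t p O gv) (fOf κ Φ t p O fv)) t + B.core1Lo) 1 - (φL κ Φ t p O.D O.DT.toDataN O.ori (gOf κ Φ t p O gv) (fOf κ Φ t p O fv)) t 1 = B.core1Lo 1 := by simp
    rw [h0, h1'] at hg
    refine ⟨g, (Skelφ.mem_Win (G := G) (φ := rootFrame (φL κ Φ t p O.D O.DT.toDataN O.ori (gOf κ Φ t p O gv) (fOf κ Φ t p O fv)) t 1)).2 ⟨graphBall_mono G t hc1R hg, ?_⟩⟩
    have hg0 : (φL κ Φ t p O.D O.DT.toDataN O.ori (gOf κ Φ t p O gv) (fOf κ Φ t p O fv)) g 0 = (φL κ Φ t p O.D O.DT.toDataN O.ori (gOf κ Φ t p O gv) (fOf κ Φ t p O fv)) t 0 + B.core1Lo 0 := by have := congrFun hgy 0; simpa using this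
    have hg1 : (φL κ Φ t p O.D O.DT.toDataN O.ori (gOf κ Φ t p O gv) (fOf κ Φ t p O fv)) g 1 = (φL κ Φ t p O.D O.DT.toDataN O.ori (gOf κ Φ t p O gv) (fOf κ Φ t p O fv)) t 1 + B.core1Lo 1 := by have := congrFun hgy 1; simpa using this
    have hrf : rootFrame (φL κ Φ t p O.D O.DT.toDataN O.ori (gOf κ Φ t p O gv) (fOf κ Φ t p O fv)) t 1 g = B.core1Lo := by
      funext i
      fin_cases i
      · show (if (0 : Fin 2) = 0 then (1 : ℤ) * ((φL κ Φ t p O.D O.DT.toDataN O.ori (gOf κ Φ t p O gv) (fOf κ Φ t p O fv)) g 0 - (φL κ Φ t p O.D O.DT.toDataN O.ori (gOf κ Φ t p O gv) (fOf κ Φ t p O fv)) t 0) else (φL κ Φ t p O.D O.DT.toDataN O.ori (gOf κ Φ t p O gv) (fOf κ Φ t p O fv)) g 1 - (φL κ Φ t p O.D O.DT.toDataN O.ori (gOf κ Φ t p O gv) (fOf κ Φ t p O fv)) t 1) = _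
        rw [if_pos rfl, one_mul, hg0]; simp
      · show (if (1 : Fin 2) = 0 then (1 : ℤ) * ((φL κ Φ t p O.D O.DT.toDataN O.ori (gOf κ Φ t p O gv) (fOf κ Φ t p O fv)) g 0 - (φL κ Φ t p O.D O.DT.toDataN O.ori (gOf κ Φ t p O gv) (fOf κ Φ t p O fv)) t 0) else (φL κ Φ t p O.D O.DT.toDataN O.ori (gOf κ Φ t p O gv) (fOf κ Φ t p O fv)) g 1 - (φL κ Φ t p O.D O.DT.toDataN O.ori (gOf κ Φ t p O gv) (fOf κ Φ t p O fv)) t 1) = _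
        rw [if_neg (by decide), hg1]; simp
    rw [hrf]; exact Finset.mem_Icc.2 ⟨le_rfl, hc1⟩
  -- the hop: the root's own long side half (`τ = 1`), its prism inside the window with root-world footprints, its target inside the bridge box
  have hlink : 1 - κ.δr 0 < (bondPercolation G q).real (linkIn (↑(Skelφ.pgramPrismFin G (φL κ Φ t p O.D O.DT.toDataN O.ori (gOf κ Φ t p O gv) (fOf κ Φ t p O fv)) t (nL κ Φ t p O.merged (gOf κ Φ t p O gv) (fOf κ Φ t p O fv)) (hL κ Φ t p O.merged (gOf κ Φ t p O gv) (fOf κ Φ t p O fv)) (3 * (ℓL κ Φ t p O.merged (gOf κ Φ t p O gv) (fOf κ Φ t p O fv))) (RL κ Φ t p O gv fv + D)) : Set V)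
      (O.merged.Λ (hP.prox t) (Mu O.merged)) (pgSideHalfW G (φL κ Φ t p O.D O.DT.toDataN O.ori (gOf κ Φ t p O gv) (fOf κ Φ t p O fv)) t (nL κ Φ t p O.merged (gOf κ Φ t p O gv) (fOf κ Φ t p O fv)) (hL κ Φ t p O.merged (gOf κ Φ t p O gv) (fOf κ Φ t p O fv)) (ℓL κ Φ t p O.merged (gOf κ Φ t p O gv) (fOf κ Φ t p O fv)) (RL κ Φ t p O gv fv + D) 1 (1 * 1))) := by
    have h := hlong_of_atQ3Px hAt hP hkit hnL t 1 (Or.inl rfl)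
    have hcube : κ.δr 0 ^ 3 ≤ κ.δr 0 := pow_le_of_le_one hδ0.le hδ1 (by norm_num)
    rw [Skelφ.StepI.coe_pgramPrismFin]
    exact lt_of_le_of_lt (sub_le_sub_left hcube 1) h
  have hQπ : ∀ w ∈ Skelφ.pgramPrismFin G (φL κ Φ t p O.D O.DT.toDataN O.ori (gOf κ Φ t p O gv) (fOf κ Φ t p O fv)) t (nL κ Φ t p O.merged (gOf κ Φ t p O gv) (fOf κ Φ t p O fv)) (hL κ Φ t p O.merged (gOf κ Φ t p O gv) (fOf κ Φ t p O fv)) (3 * (ℓL κ Φ t p O.merged (gOf κ Φ t p O gv) (fOf κ Φ t p O fv))) (RL κ Φ t p O gv fv + D), w ∈ graphBall G t Rπ := fun w hw =>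
    graphBall_mono G t hRLπ (Skelφ.pgramPrism_subset_graphBall (G := G) (φ := (φL κ Φ t p O.D O.DT.toDataN O.ori (gOf κ Φ t p O gv) (fOf κ Φ t p O fv))) t _ _ _ _ ((Skelφ.mem_pgramPrismFin G (φL κ Φ t p O.D O.DT.toDataN O.ori (gOf κ Φ t p O gv) (fOf κ Φ t p O fv))).1 hw))
  have hQfoot : ∀ w ∈ Skelφ.pgramPrismFin G (φL κ Φ t p O.D O.DT.toDataN O.ori (gOf κ Φ t p O gv) (fOf κ Φ t p O fv)) t (nL κ Φ t p O.merged (gOf κ Φ t p O gv) (fOf κ Φ t p O fv)) (hL κ Φ t p O.merged (gOf κ Φ t p O gv) (fOf κ Φ t p O fv)) (3 * (ℓL κ Φ t p O.merged (gOf κ Φ t p O gv) (fOf κ Φ t p O fv))) (RL κ Φ t p O gv fv + D), RootFootS (fcellsS κ Φ t p O.merged (gOf κ Φ t p O gv) (fOf κ Φ t p O fv) (cOf κ Φ t p O gv fv cv)) (((0 : Fin 2), true) : MDir) (fineA κ Φ t p O.merged (gOf κ Φ t p O gv) (fOf κ Φ t p O fv) (φL κ Φ t p O.D O.DT.toDataN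 O.ori (gOf κ Φ t p O gv) (fOf κ Φ t p O fv)) w) :=
    fun w hw => Skelφ.rootFootS_of_abs_le (fcellsS κ Φ t p O.merged (gOf κ Φ t p O gv) (fOf κ Φ t p O fv) (cOf κ Φ t p O gv fv cv)) (((0 : Fin 2), true) : MDir)
      (hψabs w (Skelφ.pgramPrism_subset_graphBall (G := G) (φ := (φL κ Φ t p O.D O.DT.toDataN O.ori (gOf κ Φ t p O gv) (fOf κ Φ t p O fv))) t _ _ _ _ ((Skelφ.mem_pgramPrismFin G (φL κ Φ t p O.D O.DT.toDataN O.ori (gOf κ Φ t p O gv) (fOf κ Φ t p O fv))).1 hw))) hRL5 hRLc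
  have hT₀ : ∀ w ∈ pgSideHalfW G (φL κ Φ t p O.D O.DT.toDataN O.ori (gOf κ Φ t p O gv) (fOf κ Φ t p O fv)) t (nL κ Φ t p O.merged (gOf κ Φ t p O gv) (fOf κ Φ t p O fv)) (hL κ Φ t p O.merged (gOf κ Φ t p O gv) (fOf κ Φ t p O fv)) (ℓL κ Φ t p O.merged (gOf κ Φ t p O gv) (fOf κ Φ t p O fv)) (RL κ Φ t p O gv fv + D) 1 (1 * 1), w ∈ graphBall G t Rπ ∧ rootFrame (φL κ Φ t p O.D O.DT.toDataN O.ori (gOf κ Φ t p O gv) (fOf κ Φ t p O fv)) t 1 w ∈ Finset.Icc B.B₀lo B.B₀hi :=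
    fun w hw => ⟨graphBall_mono G t hRLπ (Skelφ.pgramPrism_subset_graphBall (G := G) (φ := (φL κ Φ t p O.D O.DT.toDataN O.ori (gOf κ Φ t p O gv) (fOf κ Φ t p O fv))) t _ _ _ _ (Skelφ.coe_pgSideHalfW_subset _ _ _ _ _ _ _ hw)),
      hhopB w hw⟩
  -- the corridor's regions clear the seed ((R-F2′) numerically: `hX₁`): every region lies in `x ≥ −(q + R′ + n)` of the run frame (p5-g16's SHARP
  -- `kgCorrSched_region_fst_lower`, rows `hnR`/`hrow`), i.e. `x ≥ X₁ − q − R′ − n > Rs` in the root frame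
  have hclear₂ : ∀ k ≤ (Skelφ.kgCorrSched (HK.kgVals_ok₁ N) (HK.kgVals_ok₂ N) (HK.kgVals_split N)).N, ∀ w ∈ graphBall G t Rπ, Skelφ.runX (φL κ Φ t p O.D O.DT.toDataN O.ori (gOf κ Φ t p O gv) (fOf κ Φ t p O fv)) c₁ (nL κ Φ t p O.merged (gOf κ Φ t p O gv) (fOf κ Φ t p O fv)) (hL κ Φ t p O.merged (gOf κ Φ t p O gv) (fOf κ Φ t p O fv)) 1 w ∈ (Skelφ.kgCorrSched (HK.kgVals_ok₁ N) (HK.kgVals_ok₂ N) (HK.kgVals_split N)).region k → (KS.Rs t Dk mkP : ℤ) < rootFrame (φL κ Φ t p O.D O.DT.toDataN O.ori (gOf κ Φ t p O gv) (fOf κ Φ t p O fv)) t 1 w 0 := by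
    intro k hk w _ hw
    have h0 := Skelφ.kgCorrSched_region_fst_lower (HK.kgVals_ok₁ N) (HK.kgVals_ok₂ N) (HK.kgVals_split N) hnR hrow hk hw
    rw [Skelφ.runX_zero, Skelφ.relCoord_apply, one_mul] at h0
    have hrf : rootFrame (φL κ Φ t p O.D O.DT.toDataN O.ori (gOf κ Φ t p O gv) (fOf κ Φ t p O fv)) t 1 w 0 = (φL κ Φ t p O.D O.DT.toDataN O.ori (gOf κ Φ t p O gv) (fOf κ Φ t p O fv)) w 0 - (φL κ Φ t p O.D O.DT.toDataN O.ori (gOf κ Φ t p O gv) (fOf κ Φ t p O fv)) t 0 := by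
      show (if (0 : Fin 2) = 0 then (1 : ℤ) * ((φL κ Φ t p O.D O.DT.toDataN O.ori (gOf κ Φ t p O gv) (fOf κ Φ t p O fv)) w 0 - (φL κ Φ t p O.D O.DT.toDataN O.ori (gOf κ Φ t p O gv) (fOf κ Φ t p O fv)) t 0) else (φL κ Φ t p O.D O.DT.toDataN O.ori (gOf κ Φ t p O gv) (fOf κ Φ t p O fv)) w 1 - (φL κ Φ t p O.D O.DT.toDataN O.ori (gOf κ Φ t p O gv) (fOf κ Φ t p O fv)) t 1) = _
      rw [if_pos rfl, one_mul]
    rw [hrf]; linarith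
  -- the depth row over the prism from the closed prism box (p5-g16 KGBoxes)
  have hRdepth : ∀ z ∈ (Skelφ.kgCorrSched (HK.kgVals_ok₁ N) (HK.kgVals_ok₂ N) (HK.kgVals_split N)).prism, D₀ + (10 + 3) * ((z 0).natAbs + (z 1).natAbs) ≤ Rπ := by
    intro z hz
    have h := Skelφ.natAbs_le_of_mem_kgCorrSched_prism (HK.kgVals_ok₁ N) (HK.kgVals_ok₂ N) (HK.kgVals_split N) hz
    have h2 : ((10 : ℤ) + 3) * (((z 0).natAbs : ℤ) + (z 1).natAbs) ≤ ((10 : ℤ) + 3) * _ := mul_le_mul_of_nonneg_left h (by norm_num)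
    have : (D₀ : ℤ) + (10 + 3) * (((z 0).natAbs : ℤ) + (z 1).natAbs) ≤ Rπ := by linarith
    exact_mod_cast this
  -- assemble
  refine ⟨(B.bridgeFrame hB).N + 1 + (Skelφ.kgCorrSched (HK.kgVals_ok₁ N) (HK.kgVals_ok₂ N) (HK.kgVals_split N)).toFrame.N, hlen, ?_⟩
  exact Skelφ.rootChainF_of_bridgeSchedC hlipφ hstepφ Φ.degree_le hlipψ hwsψ (fcellsS κ Φ t p O.merged (gOf κ Φ t p O gv) (fOf κ Φ t p O fv) (cOf κ Φ t p O gv fv cv)) t (schedOfS κ Φ t p O.merged (gOf κ Φ t p O gv) (fOf κ Φ t p O fv) (cOf κ Φ t p O gv fv cv) (Sv κ Φ t p O.merged (gOf κ Φ t p O gv) (fOf κ Φ t p O fv) q)) (bOf κ Φ t p O gv fv bv) q κ.δ (((0 : Fin 2), true) : MDir) (Or.inl rfl) hRQ hRB hRQ' hRM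
    (fun c => Skelφ.pgramPrismFin G (KS.φK Φ t O.D O.DT.toDataN O.ori mk) c (KS.nKit O.merged mk) (KS.hKit t O.merged mk) (3 * KS.ℓKit t O.merged mk)
      (KS.RK t O.merged mk + D)) hRg hRgcard
    (Nat.one_le_pow _ _ (Nat.succ_pos _)) (fun c => O.merged.Λ (hP.prox c)) (Mu O.merged) hΛRg hzconn hcz hZρ hRsR hZfoot hZk
    B hB (KS0.kit0 t Dk mkP ((Mu Dk : ℤ) + 2) (KS0.r₀0 t Dk mkP Rb)) hPNb rfl hdDb hDρb (by simpa using hKCmaxb) ((KS0.R'0_eq κ Φ t p Dk mkP).2.1.le.trans hBR') (KS0.R'0_eq κ Φ t p Dk mkP).2.2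
    hwideb hdwb hDwb hTb hr₀b hr₀bR hrsb hcSb ((hreach0 _ _).trans hBR') hreachb le_rfl hRbπ Qb Fb hQb hFb (KS0.kk0 κ Φ t p Dk mkP) hNk
    hn1 c₁ (Or.inl rfl) hκL (Skelφ.kgCorrSched (HK.kgVals_ok₁ N) (HK.kgVals_ok₂ N) (HK.kgVals_split N)) (KS0.kit0 t Dk mkP ((Mu Dk + 1 : ℕ) * (Skelφ.shearUnit (nL κ Φ t p O.merged (gOf κ Φ t p O gv) (fOf κ Φ t p O fv)) (hL κ Φ t p O.merged (gOf κ Φ t p O gv) (fOf κ Φ t p O fv)) : ℤ) + 1) (KS0.r₀0 t Dk mkP (RL κ Φ t p O gv fv + D))) hPN rfl hdD hDρ hKCmax hT hr₀ hr₀R hrs hcS hreach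
    (KS0.tanOff_kit0 t Dk mkP _ _).le (KS0.R'0_eq κ Φ t p Dk mkP).2.2 (KS0.R'0_eq κ Φ t p Dk mkP).2.1.le (hreach0 _ _)
    (KS0.kk0 κ Φ t p Dk mkP) hNk hc₁ hRdepth
    hfoot₁ hfoot₂ hclear₁ hclear₂ hTne₁ hx hlastf hδ0 le_rfl hlink hQπ hQfoot hT₀ hcount hcount hk hk hbridge
    (fun hWD => Skelφ.hrouteSW_kgCorr (HK.kgVals_ok₁ N) (HK.kgVals_ok₂ N) (HK.kgVals_split N) hn1 c₁ (Or.inl rfl) le_rfl hRLπ _ hWD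
      (fun c => O.merged.Λ (hP.prox c)) (Mu O.merged) (hlong_of_atQ3Px hAt hP hkit hnL) (hlongY_of_atQ3Px hAt hP hkit hnL))
    hR₁ hR₁b hR₁r hDm

end NegB

end PlanarSkeletonFrmFrom

end Transplant

end Summit.CriticalPhenomena.PercolationContinuityZ3.Theorems

end
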